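import Mathlib
import HarnessLib

/-!
# Rejection sampling is exact: the repeat-until-accept loop outputs the normalised accepted law

HONEST FRAMING: exact (Metropolis-corrected) sampling algorithms for lattice gauge theory;
figures of merit are autocorrelation/cost numbers at stated couplings and volumes; no
continuum-physics claim.

Venture `LatticeQCDFlow` (cell pub-lqcd), topic `Exactness`, FANOUT row 9 (eng-latcore, the
engine `latflow.core`).  NEW WORK of the cell over Mathlib's measure / Markov-kernel library;
nothing here is cited as a fact.  Printed counterparts, named only: von Neumann 1951 (the
rejection method), Creutz 1980 and Kennedy–Pendleton 1985 (the SU(2) heat-bath inner draw),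
Devroye 1986 Ch. II.3.

`FibreLift.lean` proves that the single-link HEAT BATH (redraw the link from its conditional law)
is exact and says "not here: how the engine SAMPLES the SU(2) conditional (Kennedy–Pendleton
rejection)".  This file closes that gap at the level of the sampling LOOP: whatever one round
does, if it either accepts a value or rejects, i.i.d. rounds repeated until the first acceptance
output exactly the normalised accepted part of one round; with the round "propose `x ∼ q`, accept
with probability `a x`" this is thinning, and with von Neumann's envelope `a = f / (M g)` the
output is the target `f · μ / ∫ f dμ` for EVERY envelope constant `M` with `f ≤ M g` — only the
cost (`∫ f dμ / M` acceptances per round) depends on `M`.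

## Content (`X` a measurable space)

§1 The loop.  A ROUND is a probability law `ρ` on `X × Bool` (`(x, true)` = accept `x`,
`(·, false)` = reject); `accPart ρ A = ρ (A ×ˢ {true})`; `rounds ρ` = i.i.d. rounds
(`Measure.infinitePi`); `HaltsAt n` = round `n` is the first acceptance; `loopLaw ρ` = the law
of the first accepted value (a sub-probability measure: its mass is the halting probability).
`loopLaw_apply_eq_rounds` — `loopLaw ρ A` IS the probability of halting with output in `A`;
`rounds_haltsAt_inter` — `P(halt at n, output ∈ A) = ρ(reject)ⁿ ρ(A ×ˢ {true})` (geometric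
halting time, `rounds_haltsAt`); **`loopLaw_eq`** — `loopLaw ρ = ρ(accept)⁻¹ • accPart ρ`
(unconditional in `ℝ≥0∞`); `isProbabilityMeasure_loopLaw` — halts a.s. iff `ρ(accept) ≠ 0`.

§2 Thinning.  `coin a : Kernel X Bool` = Bernoulli(`a x`); round `q ⊗ₘ coin a`;
**`loopLaw_thinning`**: `loopLaw (q ⊗ₘ coin a) = (∫⁻ a dq)⁻¹ • q.withDensity a` (`q` a
probability measure, `a ≤ 1` measurable).

§3 Envelope (von Neumann).  **`loopLaw_envelope`**: reference `μ`, target density `f`, proposal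
density `g` (`∫ g dμ = 1`, `g < ∞`), `M ∉ {0, ∞}` with `f ≤ M g`, acceptance `f / (M g)`:
`loopLaw = (∫⁻ f dμ)⁻¹ • μ.withDensity f`; `accept_envelope`: acceptance probability per round
`(∫⁻ f dμ) / M`; `loopLaw_envelope'`: the same for an UNNORMALISED proposal density
(`0 < ∫ g dμ < ∞`, any finite `C ≠ 0` with `f ≤ C g`, acceptance `f / (C g)`), the form in which
samplers are written.  Dictionary (docstrings only): Kennedy–Pendleton proposes `δ = 1 - a₀` with
`g(δ) ∝ √δ e^{-αδ}` (Gamma(3/2)) and accepts with `√(1 - δ/2) ≤ 1` (`C = 1`), so its output has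
density `∝ √(δ(2-δ)) e^{-αδ} ∝ √(1 - a₀²) e^{α a₀}`, the SU(2) link conditional of
`FibreLift.lean`; Creutz 1980 proposes `∝ e^{α a₀}` on `[-1, 1]` and accepts with `√(1 - a₀²)`.
Not here: generating the Gamma(3/2) proposal from uniforms, floating point.
-/

namespace Summit.Ventures.LatticeQCDFlow.Exactness

open MeasureTheory ProbabilityTheory Set
open scoped ENNReal

variable {X : Type*} [MeasurableSpace X]

/-! ## §1 The repeat-until-accept loop over i.i.d. rounds -/

section Loop

variable (ρ : Measure (X × Bool))

/-- The accepted part of one round: `accPart ρ A = ρ (A ×ˢ {true})`. -/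
noncomputable def accPart : Measure X := (ρ.restrict (univ ×ˢ {true})).map Prod.fst

/-- I.i.d. rounds `ω : ℕ → X × Bool`. -/
noncomputable def rounds : Measure (ℕ → X × Bool) := Measure.infinitePi fun _ : ℕ => ρ

/-- The event "the loop halts at round `n`": round `n` accepts and every earlier round rejects. -/
def HaltsAt (n : ℕ) : Set (ℕ → X × Bool) := {ω | (ω n).2 = true ∧ ∀ k < n, (ω k).2 = false}

/-- **The law of the loop's output**: the value carried by the first accepting round (summed over
the halting round; a sub-probability measure whose total mass is the halting probability). -/
noncomputable def loopLaw : Measure X :=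
  Measure.sum fun n => ((rounds ρ).restrict (HaltsAt n)).map fun ω => (ω n).1

variable {ρ}

/-- Set-wise formula for the accepted part. -/
theorem accPart_apply {A : Set X} (hA : MeasurableSet A) : accPart ρ A = ρ (A ×ˢ {true}) := by
  rw [accPart, Measure.map_apply measurable_fst hA, Measure.restrict_apply (measurable_fst hA)]
  congr 1
  ext ⟨x, b⟩
  simp

omit [MeasurableSpace X] in
/-- The complement of "reject" is "accept". -/
theorem compl_univ_prod_false : (univ ×ˢ ({false} : Set Bool))ᶜ = (univ : Set X) ×ˢ {true} := by
  ext ⟨x, b⟩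
  cases b <;> simp

/-- For a probability round, `1 - ρ(reject) = ρ(accept)`. -/
theorem one_sub_reject [IsProbabilityMeasure ρ] :
    1 - ρ (univ ×ˢ {false}) = ρ (univ ×ˢ {true}) := by
  rw [← prob_compl_eq_one_sub (MeasurableSet.univ.prod (measurableSet_singleton _)),
    compl_univ_prod_false]

/-- The halting events are measurable. -/
theorem measurableSet_haltsAt (n : ℕ) : MeasurableSet (HaltsAt (X := X) n) := by
  have h : ∀ (k : ℕ) (b : Bool), MeasurableSet {ω : ℕ → X × Bool | (ω k).2 = b} := fun k b =>
    (measurable_pi_apply k).snd (measurableSet_singleton b)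
  have : HaltsAt (X := X) n = {ω | (ω n).2 = true} ∩ ⋂ k ∈ Finset.range n, {ω | (ω k).2 = false} := by
    ext ω; simp [HaltsAt]
  rw [this]
  exact (h n true).inter (Finset.measurableSet_biInter _ fun k _ => h k false)

omit [MeasurableSpace X] in
/-- The halting events are pairwise disjoint. -/
theorem disjoint_haltsAt {m n : ℕ} (hmn : m ≠ n) : Disjoint (HaltsAt (X := X) m) (HaltsAt n) := by
  rcases lt_or_gt_of_ne hmn with h | h
  · exact Set.disjoint_left.mpr fun ω hm hn => by simpa [hm.1] using hn.2 m h
  · exact Set.disjoint_left.mpr fun ω hm hn => by simpa [hn.1] using hm.2 n h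

/-- The box description of "halt at `n` with output in `A`": rounds `< n` land in `univ ×ˢ {false}`,
round `n` in `A ×ˢ {true}`. -/
def haltBox (n : ℕ) (A : Set X) (k : ℕ) : Set (X × Bool) := if k < n then univ ×ˢ {false} else A ×ˢ {true}

omit [MeasurableSpace X] in
/-- "Halt at `n` with output in `A`" is the finite box `haltBox n A` over the rounds `0, …, n`. -/
theorem haltsAt_inter_eq_pi (n : ℕ) (A : Set X) :
    HaltsAt n ∩ {ω | (ω n).1 ∈ A} = Set.pi ↑(Finset.range (n + 1)) (haltBox n A) := by
  ext ω
  simp only [HaltsAt, haltBox, mem_inter_iff, mem_setOf_eq, mem_pi, Finset.coe_range, mem_Iio]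
  constructor
  · rintro ⟨⟨hn, hk⟩, hA⟩ k hk'
    by_cases hkn : k < n
    · simp [hkn, hk k hkn]
    · obtain rfl : k = n := by omega
      simp [hA, hn]
  · intro h
    refine ⟨⟨?_, fun k hk => ?_⟩, ?_⟩
    · exact (by simpa using h n (by omega) : (ω n).1 ∈ A ∧ (ω n).2 = true).2
    · simpa [hk] using h k (by omega)
    · exact (by simpa using h n (by omega) : (ω n).1 ∈ A ∧ (ω n).2 = true).1

/-- **Halting at round `n` with output in `A` has probability `ρ(reject)ⁿ · ρ (A ×ˢ {true})`.** -/
theorem rounds_haltsAt_inter [IsProbabilityMeasure ρ] {A : Set X} (hA : MeasurableSet A) (n : ℕ) :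
    rounds ρ (HaltsAt n ∩ {ω | (ω n).1 ∈ A}) = ρ (univ ×ˢ {false}) ^ n * ρ (A ×ˢ {true}) := by
  rw [haltsAt_inter_eq_pi, rounds, Measure.infinitePi_pi]
  · rw [Finset.prod_range_succ]
    congr 1
    · rw [Finset.prod_congr rfl fun k hk => by rw [haltBox, if_pos (Finset.mem_range.mp hk)],
        Finset.prod_const, Finset.card_range]
    · rw [haltBox, if_neg (lt_irrefl n)]
  · intro k _
    unfold haltBox
    split_ifs
    · exact MeasurableSet.univ.prod (measurableSet_singleton _)
    · exact hA.prod (measurableSet_singleton _)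

/-- The halting time is geometric: `P(halt at n) = ρ(reject)ⁿ · ρ(accept)`. -/
theorem rounds_haltsAt [IsProbabilityMeasure ρ] (n : ℕ) :
    rounds ρ (HaltsAt n) = ρ (univ ×ˢ {false}) ^ n * ρ (univ ×ˢ {true}) := by
  rw [← rounds_haltsAt_inter MeasurableSet.univ n]
  congr 1
  ext ω
  simp

/-- The output law as a series over the halting round. -/
theorem loopLaw_apply_tsum {A : Set X} (hA : MeasurableSet A) :
    loopLaw ρ A = ∑' n, rounds ρ (HaltsAt n ∩ {ω | (ω n).1 ∈ A}) := by
  rw [loopLaw, Measure.sum_apply _ hA]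
  refine tsum_congr fun n => ?_
  rw [Measure.map_apply ((measurable_pi_apply n).fst) hA,
    Measure.restrict_apply (((measurable_pi_apply n).fst) hA), inter_comm]
  rfl

/-- **Semantics**: `loopLaw ρ A` is the probability that the loop halts and outputs a value in `A`. -/
theorem loopLaw_apply_eq_rounds {A : Set X} (hA : MeasurableSet A) :
    loopLaw ρ A = rounds ρ {ω | ∃ n, ω ∈ HaltsAt n ∧ (ω n).1 ∈ A} := by
  have hset : {ω : ℕ → X × Bool | ∃ n, ω ∈ HaltsAt n ∧ (ω n).1 ∈ A} =
      ⋃ n, (HaltsAt n ∩ {ω | (ω n).1 ∈ A}) := by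
    ext ω; simp
  rw [loopLaw_apply_tsum hA, hset, measure_iUnion]
  · intro m n hmn
    exact Disjoint.mono inter_subset_left inter_subset_left (disjoint_haltsAt hmn)
  · exact fun n => (measurableSet_haltsAt n).inter (((measurable_pi_apply n).fst) hA)

/-- Closed form of the series: a geometric sum times the accepted mass. -/
theorem loopLaw_apply [IsProbabilityMeasure ρ] {A : Set X} (hA : MeasurableSet A) :
    loopLaw ρ A = (ρ (univ ×ˢ {true}))⁻¹ * ρ (A ×ˢ {true}) := by
  rw [loopLaw_apply_tsum hA]
  simp_rw [rounds_haltsAt_inter hA]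
  rw [ENNReal.tsum_mul_right, ENNReal.tsum_geometric, one_sub_reject]

/-- **Rejection sampling is exact.**  The law of the first accepted value of i.i.d. rounds is the
normalised accepted part of ONE round (unconditionally in `ℝ≥0∞`: if no round can accept, both
sides vanish). -/
theorem loopLaw_eq [IsProbabilityMeasure ρ] : loopLaw ρ = (ρ (univ ×ˢ {true}))⁻¹ • accPart ρ := by
  ext A hA
  rw [loopLaw_apply hA, Measure.smul_apply, smul_eq_mul, accPart_apply hA]

/-- The loop halts almost surely — its output law is a probability measure — as soon as one round
accepts with positive probability. -/
theorem isProbabilityMeasure_loopLaw [IsProbabilityMeasure ρ] (h : ρ (univ ×ˢ {true}) ≠ 0) :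
    IsProbabilityMeasure (loopLaw ρ) :=
  ⟨by rw [loopLaw_apply MeasurableSet.univ, ENNReal.inv_mul_cancel h (measure_ne_top _ _)]⟩

end Loop

/-! ## §2 Thinning: propose `x ∼ q`, accept with probability `a x` -/

section Thinning

variable {a : X → ℝ≥0∞}

/-- Counting-measure density of a Bernoulli(`a x`) coin. -/
def coinDensity (a : X → ℝ≥0∞) (x : X) (b : Bool) : ℝ≥0∞ := bif b then a x else 1 - a x

/-- The accept/reject coin with success probability `a x`, as a Markov kernel `X → Bool`. -/
noncomputable def coin (a : X → ℝ≥0∞) : Kernel X Bool :=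
  Kernel.withDensity (Kernel.const X (Measure.count : Measure Bool)) (coinDensity a)

/-- Measurability of the coin density. -/
theorem measurable_coinDensity (ha : Measurable a) : Measurable (Function.uncurry (coinDensity a)) :=
  measurable_from_prod_countable_left fun b => by
    cases b
    · exact measurable_const.sub ha
    · exact ha

/-- The coin is an s-finite (indeed finite) kernel when `a ≤ 1`. -/
theorem isSFiniteKernel_coin (ha1 : ∀ x, a x ≤ 1) : IsSFiniteKernel (coin a) :=
  Kernel.IsSFiniteKernel.withDensity _ fun x b => by
    cases b
    · exact ne_top_of_le_ne_top ENNReal.one_ne_top tsub_le_self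
    · exact ne_top_of_le_ne_top ENNReal.one_ne_top (ha1 x)

/-- `coin a x {b} = coinDensity a x b`: heads with probability `a x`, tails with `1 - a x`. -/
theorem coin_apply_singleton (ha : Measurable a) (x : X) (b : Bool) :
    coin a x {b} = coinDensity a x b := by
  rw [coin, Kernel.withDensity_apply' _ (measurable_coinDensity ha), Kernel.const_apply,
    lintegral_singleton, Measure.count_singleton, mul_one]

/-- The coin is a Markov kernel when `a ≤ 1`. -/
theorem isMarkovKernel_coin (ha : Measurable a) (ha1 : ∀ x, a x ≤ 1) : IsMarkovKernel (coin a) := by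
  refine ⟨fun x => ⟨?_⟩⟩
  rw [coin, Kernel.withDensity_apply' _ (measurable_coinDensity ha), Kernel.const_apply,
    Measure.restrict_univ, lintegral_fintype, Fintype.sum_bool]
  simp only [coinDensity, Measure.count_singleton, mul_one, cond_true, cond_false]
  exact add_tsub_cancel_of_le (ha1 x)

/-- The thinning round is a probability law when the proposal is and `a ≤ 1`. -/
theorem isProbabilityMeasure_thinning (q : Measure X) [IsProbabilityMeasure q] (ha : Measurable a)
    (ha1 : ∀ x, a x ≤ 1) : IsProbabilityMeasure (q ⊗ₘ coin a) := by
  haveI := isMarkovKernel_coin ha ha1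
  infer_instance

/-- The thinning round: `P(x ∈ A, coin = b) = ∫_A coinDensity a x b dq`. -/
theorem thinning_apply_prod (q : Measure X) [SFinite q] (ha : Measurable a) (ha1 : ∀ x, a x ≤ 1)
    {A : Set X} (hA : MeasurableSet A) (b : Bool) :
    (q ⊗ₘ coin a) (A ×ˢ {b}) = ∫⁻ x in A, coinDensity a x b ∂q := by
  haveI := isSFiniteKernel_coin ha1
  rw [Measure.compProd_apply_prod hA (measurableSet_singleton b)]
  exact setLIntegral_congr_fun hA fun x _ => coin_apply_singleton ha x b

/-- The accepted part of the thinning round is the proposal reweighted by `a`. -/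
theorem accPart_thinning (q : Measure X) [SFinite q] (ha : Measurable a) (ha1 : ∀ x, a x ≤ 1) :
    accPart (q ⊗ₘ coin a) = q.withDensity a := by
  ext A hA
  rw [accPart_apply hA, thinning_apply_prod q ha ha1 hA, withDensity_apply _ hA]
  rfl

/-- The acceptance probability of one thinning round is `∫⁻ a dq`. -/
theorem thinning_accept (q : Measure X) [SFinite q] (ha : Measurable a) (ha1 : ∀ x, a x ≤ 1) :
    (q ⊗ₘ coin a) (univ ×ˢ {true}) = ∫⁻ x, a x ∂q := by
  rw [thinning_apply_prod q ha ha1 MeasurableSet.univ, Measure.restrict_univ]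
  rfl

/-- **Thinning is exact.**  Proposing `x ∼ q` and accepting with probability `a x ≤ 1`, repeated
until the first acceptance, outputs the normalised reweighted law `(∫⁻ a dq)⁻¹ • (a · q)`. -/
theorem loopLaw_thinning (q : Measure X) [IsProbabilityMeasure q] (ha : Measurable a)
    (ha1 : ∀ x, a x ≤ 1) : loopLaw (q ⊗ₘ coin a) = (∫⁻ x, a x ∂q)⁻¹ • q.withDensity a := by
  haveI := isProbabilityMeasure_thinning q ha ha1
  rw [loopLaw_eq, thinning_accept q ha ha1, accPart_thinning q ha ha1]

/-- … and it halts almost surely iff the mean acceptance `∫⁻ a dq` is non-zero. -/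
theorem isProbabilityMeasure_loopLaw_thinning (q : Measure X) [IsProbabilityMeasure q]
    (ha : Measurable a) (ha1 : ∀ x, a x ≤ 1) (hpos : ∫⁻ x, a x ∂q ≠ 0) :
    IsProbabilityMeasure (loopLaw (q ⊗ₘ coin a)) := by
  haveI := isProbabilityMeasure_thinning q ha ha1
  exact isProbabilityMeasure_loopLaw (by rwa [thinning_accept q ha ha1])

end Thinning

/-! ## §3 Von Neumann's envelope: target `f · μ`, proposal `g · μ`, `f ≤ M g`, accept `f / (M g)` -/

section Envelope

variable {μ : Measure X} {f g : X → ℝ≥0∞} {M : ℝ≥0∞}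

omit [MeasurableSpace X] in
/-- The envelope acceptance function `f / (M g)` is at most one when `f ≤ M g`. -/
theorem envelope_accept_le_one (hfg : ∀ x, f x ≤ M * g x) (x : X) : f x / (M * g x) ≤ 1 :=
  ENNReal.div_le_of_le_mul (by rw [one_mul]; exact hfg x)

/-- The envelope acceptance function is measurable. -/
theorem measurable_envelope_accept (hf : Measurable f) (hg : Measurable g) :
    Measurable fun x => f x / (M * g x) := hf.div (measurable_const.mul hg)

omit [MeasurableSpace X] in
/-- Pointwise: proposal density times envelope acceptance is `M⁻¹ f` (also where `g = 0`, since
then `f = 0`). -/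
theorem mul_envelope_accept (hg_top : ∀ x, g x ≠ ∞) (hM0 : M ≠ 0) (hMtop : M ≠ ∞)
    (hfg : ∀ x, f x ≤ M * g x) (x : X) : g x * (f x / (M * g x)) = M⁻¹ * f x := by
  by_cases hg0 : g x = 0
  · have hf0 : f x = 0 := le_zero_iff.mp (by simpa [hg0] using hfg x)
    simp [hg0, hf0]
  · rw [div_eq_mul_inv, ENNReal.mul_inv (Or.inl hM0) (Or.inl hMtop)]
    calc g x * (f x * (M⁻¹ * (g x)⁻¹)) = M⁻¹ * f x * (g x * (g x)⁻¹) := by ring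
      _ = M⁻¹ * f x := by rw [ENNReal.mul_inv_cancel hg0 (hg_top x), mul_one]

/-- The accepted part of the envelope round is `M⁻¹ • (f · μ)`. -/
theorem withDensity_envelope (hf : Measurable f) (hg : Measurable g) (hg_top : ∀ x, g x ≠ ∞)
    (hM0 : M ≠ 0) (hMtop : M ≠ ∞) (hfg : ∀ x, f x ≤ M * g x) :
    (μ.withDensity g).withDensity (fun x => f x / (M * g x)) = M⁻¹ • μ.withDensity f := by
  rw [← withDensity_mul _ hg (measurable_envelope_accept hf hg), ← withDensity_smul _ hf]
  congr 1
  funext x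
  simp only [Pi.mul_apply, Pi.smul_apply, smul_eq_mul]
  exact mul_envelope_accept hg_top hM0 hMtop hfg x

/-- The mean acceptance of the envelope round is `M⁻¹ ∫⁻ f dμ`. -/
theorem lintegral_envelope_accept (hf : Measurable f) (hg : Measurable g) (hg_top : ∀ x, g x ≠ ∞)
    (hM0 : M ≠ 0) (hMtop : M ≠ ∞) (hfg : ∀ x, f x ≤ M * g x) :
    ∫⁻ x, f x / (M * g x) ∂(μ.withDensity g) = M⁻¹ * ∫⁻ x, f x ∂μ := by
  rw [lintegral_withDensity_eq_lintegral_mul _ hg (measurable_envelope_accept hf hg),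
    ← lintegral_const_mul _ hf]
  exact lintegral_congr fun x => by
    simpa only [Pi.mul_apply] using mul_envelope_accept hg_top hM0 hMtop hfg x

/-- A density integrating to one gives a probability measure. -/
theorem isProbabilityMeasure_withDensity_of_lintegral (hg1 : ∫⁻ x, g x ∂μ = 1) :
    IsProbabilityMeasure (μ.withDensity g) :=
  ⟨by rw [withDensity_apply _ MeasurableSet.univ, Measure.restrict_univ, hg1]⟩

/-- **Von Neumann rejection sampling is exact.**  Reference measure `μ`, measurable target density
`f`, probability proposal density `g < ∞`, an envelope constant `M ∉ {0, ∞}` with `f ≤ M g`: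
proposing from `g · μ` and accepting with probability `f / (M g)` until the first acceptance
outputs EXACTLY the normalised target `(∫⁻ f dμ)⁻¹ • (f · μ)` — whatever the envelope constant. -/
theorem loopLaw_envelope [SFinite μ] (hf : Measurable f) (hg : Measurable g)
    (hg_top : ∀ x, g x ≠ ∞) (hg1 : ∫⁻ x, g x ∂μ = 1) (hM0 : M ≠ 0) (hMtop : M ≠ ∞)
    (hfg : ∀ x, f x ≤ M * g x) :
    loopLaw ((μ.withDensity g) ⊗ₘ coin fun x => f x / (M * g x)) = (∫⁻ x, f x ∂μ)⁻¹ • μ.withDensity f := by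
  haveI := isProbabilityMeasure_withDensity_of_lintegral hg1
  rw [loopLaw_thinning _ (measurable_envelope_accept hf hg) (envelope_accept_le_one hfg),
    lintegral_envelope_accept hf hg hg_top hM0 hMtop hfg, withDensity_envelope hf hg hg_top hM0 hMtop hfg,
    smul_smul, ENNReal.mul_inv (Or.inl (ENNReal.inv_ne_zero.mpr hMtop)) (Or.inl (ENNReal.inv_ne_top.mpr hM0)),
    inv_inv, mul_comm M, mul_assoc, ENNReal.mul_inv_cancel hM0 hMtop, mul_one]

/-- The cost side: one envelope round accepts with probability `(∫⁻ f dμ) / M`. -/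
theorem accept_envelope [SFinite μ] (hf : Measurable f) (hg : Measurable g)
    (hg_top : ∀ x, g x ≠ ∞) (hM0 : M ≠ 0) (hMtop : M ≠ ∞) (hfg : ∀ x, f x ≤ M * g x) :
    ((μ.withDensity g) ⊗ₘ coin fun x => f x / (M * g x)) (univ ×ˢ {true}) = (∫⁻ x, f x ∂μ) / M := by
  rw [thinning_accept _ (measurable_envelope_accept hf hg) (envelope_accept_le_one hfg),
    lintegral_envelope_accept hf hg hg_top hM0 hMtop hfg, mul_comm, div_eq_mul_inv]

/-- … so the envelope loop halts almost surely iff the target has non-zero mass. -/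
theorem isProbabilityMeasure_loopLaw_envelope [SFinite μ] (hf : Measurable f) (hg : Measurable g)
    (hg_top : ∀ x, g x ≠ ∞) (hg1 : ∫⁻ x, g x ∂μ = 1) (hM0 : M ≠ 0) (hMtop : M ≠ ∞)
    (hfg : ∀ x, f x ≤ M * g x) (hf0 : ∫⁻ x, f x ∂μ ≠ 0) :
    IsProbabilityMeasure (loopLaw ((μ.withDensity g) ⊗ₘ coin fun x => f x / (M * g x))) := by
  haveI := isProbabilityMeasure_withDensity_of_lintegral hg1
  refine isProbabilityMeasure_loopLaw_thinning _ (measurable_envelope_accept hf hg)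
    (envelope_accept_le_one hfg) ?_
  rw [lintegral_envelope_accept hf hg hg_top hM0 hMtop hfg]
  exact mul_ne_zero (ENNReal.inv_ne_zero.mpr hMtop) hf0

/-- **Unnormalised form** (how samplers are written): proposal density `g` up to normalisation
(`0 < ∫ g dμ < ∞`, proposal law `(∫ g)⁻¹ • g · μ`), any finite `C ≠ 0` with `f ≤ C g`, acceptance
`f / (C g)`; the loop outputs `(∫⁻ f dμ)⁻¹ • (f · μ)` (Kennedy–Pendleton / Creutz: `C = 1`). -/
theorem loopLaw_envelope' [SFinite μ] (hf : Measurable f) (hg : Measurable g)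
    (hg_top : ∀ x, g x ≠ ∞) (hZ0 : ∫⁻ x, g x ∂μ ≠ 0) (hZtop : ∫⁻ x, g x ∂μ ≠ ∞)
    {C : ℝ≥0∞} (hC0 : C ≠ 0) (hCtop : C ≠ ∞) (hfg : ∀ x, f x ≤ C * g x) :
    loopLaw (((∫⁻ x, g x ∂μ)⁻¹ • μ.withDensity g) ⊗ₘ coin fun x => f x / (C * g x)) =
      (∫⁻ x, f x ∂μ)⁻¹ • μ.withDensity f := by
  set Z := ∫⁻ x, g x ∂μ
  -- normalised proposal density `g' = Z⁻¹ g` and envelope constant `M = C Z`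
  have hg' : Measurable fun x => Z⁻¹ * g x := measurable_const.mul hg
  have hg'_top : ∀ x, Z⁻¹ * g x ≠ ∞ := fun x => ENNReal.mul_ne_top (ENNReal.inv_ne_top.mpr hZ0) (hg_top x)
  have hg'1 : ∫⁻ x, Z⁻¹ * g x ∂μ = 1 := by
    rw [lintegral_const_mul _ hg, ENNReal.inv_mul_cancel hZ0 hZtop]
  have hM0 : C * Z ≠ 0 := mul_ne_zero hC0 hZ0
  have hMtop : C * Z ≠ ∞ := ENNReal.mul_ne_top hCtop hZtop
  have hfg' : ∀ x, f x ≤ C * Z * (Z⁻¹ * g x) := fun x => by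
    rw [mul_assoc, ← mul_assoc Z, ENNReal.mul_inv_cancel hZ0 hZtop, one_mul]; exact hfg x
  have hacc : (fun x => f x / (C * g x)) = fun x => f x / (C * Z * (Z⁻¹ * g x)) := by
    funext x; rw [mul_assoc, ← mul_assoc Z, ENNReal.mul_inv_cancel hZ0 hZtop, one_mul]
  have hprop : Z⁻¹ • μ.withDensity g = μ.withDensity fun x => Z⁻¹ * g x := by
    rw [← withDensity_smul _ hg]; rfl
  rw [hprop, hacc]
  exact loopLaw_envelope hf hg' hg'_top hg'1 hM0 hMtop hfg'

end Envelope

end Summit.Ventures.LatticeQCDFlow.Exactness
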